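import Literature.MathematicalPhysics.QuantumFieldTheory.Balaban1983to89.B11Eq174ChartLipschitzAtFlatLatticeFreeClosed
import Summits.QuantumFields.BalabanUV.T4Continuum.Support.NE9CurChartTowerPiLatticeUniformFlatWitness

/-!
# NE9CurChartTowerPiLipschitzAtFlatLatticeUniform — THE CHART OF THE CURVE SPECIES `cur U` FOR PRINT's `k`-TH-STEP OPERATOR (3.122) IS LIPSCHITZ IN THE
# BACKGROUND AT THE FLAT POINT WITH ONE CONSTANT FOR EVERY HEIGHT `k = n+1`, EVERY SPACING ON THE DIAGONAL, EVERY PERIOD `m`: for every background `U` of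
# the cell's MODEL block (print's windows `‖U(b) − 1‖ ≤ αη`, `‖U(∂p) − 1‖ ≤ αη²`, …, current window `‖J‖ ≤ j₀`), every pair of admissible (L3) slots with a
# background modulus `δ_W` and a displayed `C_k`-modulus `δ_C` on one ball, and every block field `B ∈ ball 0 R_b`:
# `‖ι(chart_U B) − chart_1 B‖_(115),∇_1 ≤ K·((j₀ + α) + δ_W + δ_C)` with `α₁ j₁ ε₄ ε_C R_b r K` chosen BEFORE `∀ n η m U` — the LATTICE-UNIFORM twin of (Z)
# `Support/NE9CurChartLipschitzAtFlat` (fixed lattice, finite-lattice `K`), i.e. ROUTE (J′) of the NE9 crux team at the Support face; cell `pub-balaban`, T4-DAG §2 node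
# U3 ∕ §6 NE9, WALL-NE9-P1 §3 (ii); NE9 crux-team (2) LEAF PROVER 01 (`b2b-balaban-t4-ne9-formalise-leaf-01`, gen 104); Summits-side NEW leaf under this seat's
# INTERFACE REQUEST NE9 [NE9LEAF01-G104-IFR] (HOME/INBOX.md; ruling e34b3e0c (0) «no new leaves unless a CRUX prover requests a specific NAMED interface»);
# nothing printed asserted

HONEST FRAMING (T4-DAG PAGE 1).  Rung (B)+1 of the FINITE-VOLUME T⁴ programme — NOT infinite volume, NOT a mass gap, NOT the Clay problem.  NE9 is a
cell NEW ESTIMATE, NOT PRINTED in [Balaban1987RG1] ∕ [Balaban1988RG2Cluster], and NOT PROVED here («NE9 ⇐ the named binders»; spine PROVED 0∕9).  HONEST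
DEPENDENCY (cell line, verbatim): continuum YM on T⁴ ⇐ BetaPertH ∧ nine spine estimates (0/9 proved); BetaPertH ⇐ (D1) ∧ (D4) ∧ CAP+tail; G-an2-4
gates asym, D1 and NE2/3/4.  The `cur U` OBJECT is ONE item of the MODEL O-NE9-1 (species (a) data); `act` ∕ `ker` and NEEDS-COORDINATOR #5 untouched.

WHAT THIS FILE PROVES (ONE theorem + two flat-spelling identities; 0 def, 0 sorry, axioms standard).  **`cur_chart_tower_pi_lipschitz_at_flat_lattice_uniform`** —
for fixed `L`, the fibre ∕ trace letters, print's `a, a′ > 0`, the level-profile room `(ϱ, AQ, ρ_w)`, `C_k`'s numerics (`G ≤ U1` averaging-closed, `α₀`, `ρ`), the (L3)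
constants `(C₄, a₃)`, two numbers `ω, Ω ≥ 0` bounding the (115) weight profile, and the realification basis `b` of `𝔸`: `∃ α₁ j₁ ε₄ ε_C R_b r K` (all `> 0`) BEFORE
`∀`, such that for EVERY height `n`, spacing `η` on the diagonal, period `m`, background `U` with the MODEL block's data VERBATIM (the binder block of this lineage's
`B11Eq174ChartLipschitzAtFlatLatticeFreeClosed.exists_chartHB_lipschitz_at_flat_latticeFree`: per-level profile, windows, unitarity, ANY positivity ∕ onto witnesses
`hpos′ hpos hposπ hQ` at `U` and `hpos′₁ hpos₁ hQ1` at the vacuum), `Ũ ∈ G`, level maps with `n+1 ≤ lev₀` and weight profile `w̄₀, w̄₁ ≤ ω`, `w̲₁⁻¹, w̲₃⁻¹, w̲_B⁻¹ ≤ Ω`,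
every pair of (L3) slots `W₁` (over `∇_U`), `W₂` (over `∇_1`) with `QuadAnalytic · C₄ a₃`, every DISPLAYED moduli `δ_W, δ_C ≥ 0` with
`‖W₁P − W₂(ιP)‖ ≤ δ_W` and `‖C_k(U)P − C_k(1)(ιP)‖ ≤ δ_C` on `‖P‖ < r`, and every `B` with `‖B‖ < R_b`:
`‖ι(chartHB 𝔊̃_k(U) 0 W₁ 0 (A′ ↦ A′ + solA H̃_{1,k}(U) 0 C_k(U) 0 ε_C A′) ε₄ H̃_{1,k}(U) B) − chartHB 𝔊_k(1) 0 W₂ 0 (…) ε₄ H_{1,k}(1) B‖ ≤ K·((j₀ + α) + δ_W + δ_C)`.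
PROOF = (Z)'s outer assembly at the tower with LATTICE-FREE suppliers: `exists_chartHB_lipschitz_at_flat_latticeFree` (the chart-level composition with the letter
defects `δ̃_A`, `δ̃_G`, `K_ι` PRODUCED free of the lattice — ROUTE (J′): this lineage's gens 99–104, the located letter `Hω` discharged in gen 104); the two operator norms
`exists_norm_chartLetters_le` at `U` and at the vacuum (the vacuum is in the class with `α = 0`, `j₀ = 0`: `NE9CurChartTowerPiLatticeUniformFlatWitness.flat_mem_class`; print's
letters at the vacuum ARE the chain's: `B9Eq3119DeltaPiTowerFlat.letters_laplaceAkPi_one`, §1); the scalar letters WITH ROOM `B11Eq118RegimeScalars.exists_twoRegimes_radii_of_bounds_room_cap`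
at `(B₀, b, b₁) := ω·M_φBM_φ′·Ω`, `(C₂, c₄) := (C2T d α₀, ρ)`; `C_k`'s `QuadAnalytic` at `U` and at `1` (`B11Eq44CLetterTower.quadAnalytic_Cck`, (52) from the plaquette
window); the radius bookkeeping `ρ := 2(ε₄ + a)`, `s := ε₄ + a` under `K_ι = 1 + w̄₁·2α·w̲₁⁻¹ ≤ 2` (`α ≤ 1∕(2ωΩ + 1)`).
DISGUISE TEST: composition by name of landed theorems; no inequality of the series proved HERE; constants crude and symbolic (NOT print's `B₀`); `j₀` and `α`
displayed separately; the per-level profile, the positivity ∕ surjectivity witnesses, the weight-profile bounds, the (L3) slots WITH their modulus `δ_W` and the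
`C_k`-modulus `δ_C` stay DISPLAYED (their lattice-free discharge = the successor's bricks: `C_k` two-background at the tower, the (3.122) current letter, the V₀-group);
NOT the gauge step of p. 416, NOT claimed that Bałaban's 𝐇_k ∕ U_j(□₀, exp iB) meet these letters (O-NE9-1; #5 UNRULED); not NE9.  What IS new relative to (Z): NO
constant depends on the height, the spacing or the period.
References (TYPES ∕ loci only): [Balaban1985Variational] (44)–(47) p. 285, (103) p. 293, Prop. 6 (117)–(121) p. 295, (172)–(175) p. 305, Prop. 9 p. 309;
[Balaban1985BackgroundPropagators] (3.35)–(3.37) p. 396, Thm 3.1 (3.42)∕(3.47) pp. 397–398, Thm 3.4 p. 400, (3.122)–(3.126) p. 420, (3.152)–(3.153) p. 426, Thm 3.13 p. 426;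
[Balaban1985Averaging] Prop. 2 (52)–(54) p. 26.
-/

noncomputable section

open Metric Set

namespace Summit.QuantumFields.BalabanUV.T4Continuum.NE9CurChartTowerPiLipschitzAtFlatLatticeUniform

open scoped InnerProductSpace ComplexConjugate BigOperators
open Literature.MathematicalPhysics.QuantumFieldTheory.Balaban1983to89
open B11Eq103H1Complex B11Eq115Space B11Eq174Chart
open B11Eq111FrakG (nabla115 jetLinearEquiv)
open B13Contraction113 (QuadAnalytic)
open B9SectCLatticeCarrier (Bond bpos btgt shift unshift)
open B4Sect5Torus (TSite)
open B7Prop1Explicit (U1 Wcx boxVec)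
open B7Prop2Explicit (pdev AvgClosed C0 c2')
open B7Prop3Flat (c3)
open B9Eq315QTorus (perCfg cornerSite)
open B9Eq315QTower (towerP UlevOf)
open B9Eq315QTowerFlat (perCfg_UlevOf_one_mem_U1 norm_Wcx_UlevOf_one_sub_one_le UlevOf_one)
open B9Eq326OperatorTower (QkW laplaceAk RofUk)
open B9Eq310HessianOperator (adTransportW hessOp)
open B9Eq310DeltaPrime (plaqHolU plaqHolU_one)
open B9Eq324DeltaPrimeATower (laplacePrimeAk)
open B9Eq3119DeltaPiTower (laplaceAkPi)
open B9Eq3119DeltaPiTowerFlat (laplaceAkPi_one_pos_iff letters_laplaceAkPi_one)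
open B11Eq118RegimeScalars (exists_twoRegimes_radii_of_bounds_room_cap)
open B11Eq44COperatorTower (C2T C2T_nonneg)
open B11Eq44CLetterTower (Cck quadAnalytic_Cck)
open B7Eq43AveragedSmallnessLevelFree (pdev_perCfg_le_of_plaq)
open B11Eq117ChartLettersOnModel (exists_norm_chartLetters_le)
open B11Eq174ChartLipschitzAtFlatLatticeFreeClosed (exists_chartHB_lipschitz_at_flat_latticeFree)
open Summit.QuantumFields.BalabanUV.T4Continuum.NE9CurChartTowerPiLatticeUniformFlatWitness (flat_mem_class)

variable {d : ℕ} (hd : 1 ≤ d) (L : ℕ) [NeZero L] (hL : 1 ≤ L) (hL2 : 2 ≤ L) (hL3 : 3 ≤ L) [Fact (0 < (L : ℝ))]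
  {𝔸 : Type*} [NormedRing 𝔸] [NormedAlgebra ℂ 𝔸] [CompleteSpace 𝔸] [NormOneClass 𝔸] [StarRing 𝔸] [NormedStarGroup 𝔸] [StarModule ℂ 𝔸] [FiniteDimensional ℂ 𝔸]
  {W : Type*} [NormedAddCommGroup W] [InnerProductSpace ℂ W] [FiniteDimensional ℂ W] (φ : W ≃ₗ[ℂ] 𝔸)
  {Mφ Mφ' : ℝ} (hMφ : 0 ≤ Mφ) (hMφ' : 0 ≤ Mφ') (hφ : ∀ w, ‖φ w‖ ≤ Mφ * ‖w‖) (hφ' : ∀ X, ‖φ.symm X‖ ≤ Mφ' * ‖X‖) (hstar : ∀ X : 𝔸, ‖star X‖ ≤ ‖X‖)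
  {a : ℝ} (ha : 0 < a) {a' : ℝ} (ha' : 0 < a') {ϱ : ℝ} (hϱ0 : 0 ≤ ϱ) (hϱ1 : ϱ < 1)
  (τ : 𝔸 →ₗ[ℂ] ℂ) {Cτ : ℝ} (hτ : ∀ X, ‖τ X‖ ≤ Cτ * ‖X‖) (hCτ : 0 ≤ Cτ) {Mτ : ℝ} (hτm : ∀ X Y : 𝔸, ‖τ (X * Y)‖ ≤ Mτ * ‖X‖ * ‖Y‖) (hMτ : 0 ≤ Mτ)
  {ρw : ℝ} (hρw : 0 ≤ ρw)
  (hτ₁ : ∀ X : 𝔸, τ (star X) = conj (τ X)) (hτ₂ : ∀ X Y : 𝔸, τ (X * Y) = τ (Y * X)) (hφτ : ∀ X Y : 𝔸, ⟪φ.symm X, φ.symm Y⟫_ℂ = τ (star X * Y))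
  (AQ : ℝ)
  {ι : Type} [Fintype ι] [DecidableEq ι] (b : Module.Basis ι ℝ 𝔸) {M₂ : ℝ} (hM₂ : 0 ≤ M₂) (hrepr : ∀ (v : 𝔸) (i : ι), |b.repr v i| ≤ M₂ * ‖v‖)
  {G : Subgroup 𝔸ˣ} (hG : AvgClosed d L G) {α₀ : ℝ} (hα₀ : 0 < α₀) (hα3 : C0 d * α₀ ≤ 1 / 3) (hα4 : 4 * α₀ ≤ c2' d L)
  {ρ : ℝ} (hρ0 : 0 < ρ) (hρ : Real.exp (4 * (800 * ((d : ℝ) + 1) ^ 2 * ((d : ℝ) + 4)) * α₀) * (1 + 8 * (131072 * ((d : ℝ) + 1) ^ 2) * ρ) ≤ 2)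
  (hρc : 2 * ρ ≤ c3 d L) {C₄ a₃ : ℝ} (hC₄ : 0 ≤ C₄) (ha₃ : 0 < a₃) {ω Ω : ℝ} (hω : 0 ≤ ω) (hΩ : 0 ≤ Ω)

/-! ## §1 Print's letters at the vacuum ARE the chain's, in the chart's type (for any positivity ∕ onto witnesses) -/

section FlatSpelling

variable (m : Fin d → ℕ) [∀ i, NeZero (m i)] (n : ℕ) (η : ℝ) [Fact (0 < η)] {c₀ c₁ : ℝ} [Fact (0 < c₀)] [Fact (0 < c₁)]
  (hpos'₁ : ∀ x : SiteL2K ℂ d (towerP L m (n + 1)) c₀ W, x ≠ 0 →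
    0 < RCLike.re ⟪x, laplacePrimeAk L m n φ η (fun _ : Bond d (towerP L m (n + 1)) => (1 : 𝔸ˣ)) a' (c₁ := c₁) x⟫_ℂ)
  (hpos₁ : ∀ x : BondL2K ℂ d (towerP L m (n + 1)) c₀ W, x ≠ 0 →
    0 < RCLike.re ⟪x, laplaceAk L m n φ η (fun _ : Bond d (towerP L m (n + 1)) => (1 : 𝔸ˣ)) hL (fun _ => 0) (fun _ => by norm_num)
      (perCfg_UlevOf_one_mem_U1 L m (n + 1)) (norm_Wcx_UlevOf_one_sub_one_le L m (n + 1) (fun _ => 0) (fun _ => le_rfl)) τ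
      (c₀ := c₀) (c₁ := c₁) a x⟫_ℂ)
  (hposπ₁ : ∀ x : BondL2K ℂ d (towerP L m (n + 1)) c₀ W, x ≠ 0 →
    0 < RCLike.re ⟪x, laplaceAkPi L m n φ τ η (fun _ : Bond d (towerP L m (n + 1)) => (1 : 𝔸ˣ)) a' hpos'₁ hL (fun _ => 0) (fun _ => by norm_num)
      (perCfg_UlevOf_one_mem_U1 L m (n + 1)) (norm_Wcx_UlevOf_one_sub_one_le L m (n + 1) (fun _ => 0) (fun _ => le_rfl)) (c₁ := c₁) a x⟫_ℂ)
  (hQ1 : Function.Surjective (QkW L m n φ (fun _ : Bond d (towerP L m (n + 1)) => (1 : 𝔸ˣ)) hL (fun _ => 0) (fun _ => by norm_num)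
    (perCfg_UlevOf_one_mem_U1 L m (n + 1)) (norm_Wcx_UlevOf_one_sub_one_le L m (n + 1) (fun _ => 0) (fun _ => le_rfl)) (c₀ := c₀) (c₁ := c₁)))
  (lev₀ : Bond d (towerP L m (n + 1)) → ℕ) (levB : Bond d m → ℕ) (lev₁ : Bond d (towerP L m (n + 1)) × Fin d → ℕ)

omit [NormedStarGroup 𝔸] in
set_option maxRecDepth 8192 in
set_option maxHeartbeats 1600000 in
/-- **`𝔊̃_k(1) = 𝔊_k(1)` IN THE CHART's TYPE**: the (115)-valued chart letter built on print's operator `Δ̃_{a,k}(1)` (any positivity ∕ onto witnesses) IS the one built on the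
chain's `Δ_{a,k}(1)` — `B9Eq3119DeltaPiTowerFlat.letters_laplaceAkPi_one` (`G̃₁(1) = G₁(1)`, `K̃⁻¹(1) = K⁻¹(1)`) under `frakGLatticeCLM`. [folklore]
[cite: Balaban1985BackgroundPropagators, (3.122) p.420, (3.153) p.426] -/
theorem frakGLatticeCLM_laplaceAkPi_one :
    frakGLatticeCLM (L := (L : ℝ)) (η := η) (lev₀ := lev₀) φ hposπ₁ hQ1 lev₁ (nabla115 η (fun _ : Bond d (towerP L m (n + 1)) => (1 : 𝔸ˣ))) =
      frakGLatticeCLM (L := (L : ℝ)) (η := η) (lev₀ := lev₀) (c := ((η : ℂ))⁻¹)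
              (R := adTransportW φ (fun _ : Bond d (towerP L m (n + 1)) => (1 : 𝔸ˣ)))
              (S := adTransportW φ fun _ : Bond d (towerP L m (n + 1)) => (1 : 𝔸ˣ)⁻¹) (Δ₁ := hessOp φ η (fun _ : Bond d (towerP L m (n + 1)) => (1 : 𝔸ˣ)) τ)
              (Rr := RofUk L m n φ η (fun _ : Bond d (towerP L m (n + 1)) => (1 : 𝔸ˣ)))
              (Q := (QkW L m n φ (fun _ : Bond d (towerP L m (n + 1)) => (1 : 𝔸ˣ)) hL (fun _ => 0) (fun _ => by norm_num)
                (perCfg_UlevOf_one_mem_U1 L m (n + 1)) (norm_Wcx_UlevOf_one_sub_one_le L m (n + 1) (fun _ => 0) (fun _ => le_rfl)) (c₀ := c₀) (c₁ := c₁))) (a := a)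
              φ hpos₁ hQ1 lev₁ (nabla115 η (fun _ : Bond d (towerP L m (n + 1)) => (1 : 𝔸ˣ))) := by
  have h := letters_laplaceAkPi_one L m n φ τ η a' hpos'₁ hL (fun _ => 0) (fun _ => by norm_num) (perCfg_UlevOf_one_mem_U1 L m (n + 1))
    (norm_Wcx_UlevOf_one_sub_one_le L m (n + 1) (fun _ => 0) (fun _ => le_rfl)) a hposπ₁ hpos₁ hQ1
  unfold frakGLatticeCLM
  rw [h.1, h.2.1]

omit [NormedStarGroup 𝔸] in
set_option maxRecDepth 8192 in
set_option maxHeartbeats 1600000 in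
/-- **`H̃_{1,k}(1) = H_{1,k}(1)` IN THE CHART's TYPE** ((3.126) at the vacuum, under `H1LatticeCLM`). [folklore] [cite: Balaban1985BackgroundPropagators, (3.122) p.420, (3.126) p.420] -/
theorem H1LatticeCLM_laplaceAkPi_one :
    H1LatticeCLM (L := (L : ℝ)) (η := η) (lev₀ := lev₀) (levB := levB) φ hposπ₁ hQ1 lev₁ (nabla115 η (fun _ : Bond d (towerP L m (n + 1)) => (1 : 𝔸ˣ))) =
      H1LatticeCLM (L := (L : ℝ)) (η := η) (lev₀ := lev₀) (levB := levB) (c := ((η : ℂ))⁻¹)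
              (R := adTransportW φ (fun _ : Bond d (towerP L m (n + 1)) => (1 : 𝔸ˣ)))
              (S := adTransportW φ fun _ : Bond d (towerP L m (n + 1)) => (1 : 𝔸ˣ)⁻¹) (Δ₁ := hessOp φ η (fun _ : Bond d (towerP L m (n + 1)) => (1 : 𝔸ˣ)) τ)
              (Rr := RofUk L m n φ η (fun _ : Bond d (towerP L m (n + 1)) => (1 : 𝔸ˣ)))
              (Q := (QkW L m n φ (fun _ : Bond d (towerP L m (n + 1)) => (1 : 𝔸ˣ)) hL (fun _ => 0) (fun _ => by norm_num)
                (perCfg_UlevOf_one_mem_U1 L m (n + 1)) (norm_Wcx_UlevOf_one_sub_one_le L m (n + 1) (fun _ => 0) (fun _ => le_rfl)) (c₀ := c₀) (c₁ := c₁))) (a := a)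
              φ hpos₁ hQ1 lev₁ (nabla115 η (fun _ : Bond d (towerP L m (n + 1)) => (1 : 𝔸ˣ))) := by
  have h := letters_laplaceAkPi_one L m n φ τ η a' hpos'₁ hL (fun _ => 0) (fun _ => by norm_num) (perCfg_UlevOf_one_mem_U1 L m (n + 1))
    (norm_Wcx_UlevOf_one_sub_one_le L m (n + 1) (fun _ => 0) (fun _ => le_rfl)) a hposπ₁ hpos₁ hQ1
  unfold H1LatticeCLM
  rw [h.2.2.1]

end FlatSpelling

/-! ## §2 The face -/

-- deep definitional unfolding `laplaceAkPi` ↦ `laplaceALatticeK … (π†Δπ) …` in the statement (as the host)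
set_option maxRecDepth 8192 in
set_option maxHeartbeats 6400000 in
include hd hL hL2 hL3 hMφ hMφ' hφ hφ' hstar ha ha' hϱ0 hϱ1 hτ hCτ hτm hMτ hρw hτ₁ hτ₂ hφτ hM₂ hrepr hG hα₀ hα3 hα4 hρ0 hρ hρc hC₄ ha₃ hω hΩ in
/-- **THE CHART OF `cur U` AT PRINT's OPERATOR (3.122) IS LIPSCHITZ IN THE BACKGROUND AT THE FLAT POINT, LATTICE-UNIFORMLY** — see the module header:
`‖ι(chart_U B) − chart_1 B‖ ≤ K·((j₀ + α) + δ_W + δ_C)` for every lattice of the tower, every background of the MODEL block, `B ∈ ball 0 R_b`, with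
`α₁ j₁ ε₄ ε_C R_b r K` BEFORE `∀`; the (L3) slots' modulus `δ_W` and `C_k`'s modulus `δ_C` displayed. [folklore]
[cite: Balaban1985Variational, Prop. 6 (116)–(121) p.295, (117) p.295, (174)–(175) p.305, (47) p.284, Prop. 9 p.309; Balaban1985BackgroundPropagators, Thm 3.4 p.400, (3.122) p.420, (3.126) p.420, (3.153) p.426, Thm 3.13 p.426] -/
theorem cur_chart_tower_pi_lipschitz_at_flat_lattice_uniform :
    ∃ α₁ j₁ ε₄ εC Rb r K : ℝ, 0 < α₁ ∧ 0 < j₁ ∧ 0 < ε₄ ∧ 0 < εC ∧ 0 < Rb ∧ 0 < r ∧ 0 < K ∧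
      ∀ (n : ℕ) (η : ℝ) [Fact (0 < η)] (_hηL : η * (L : ℝ) ^ (n + 1) = 1) (c₀ c₁ : ℝ) [Fact (0 < c₀)] [Fact (0 < c₁)]
        (_hw : c₀ * ((L : ℝ) ^ (n + 1)) ^ d = c₁) (_hρ : |η| ^ d / c₀ ≤ ρw) (m : Fin d → ℕ) [∀ i, NeZero (m i)] (_hm : ∀ i, 1 ≤ m i)
        (U : Bond d (towerP L m (n + 1)) → 𝔸ˣ) (αU : ℕ → ℝ) (_hα0 : ∀ j, 0 ≤ αU j) (hα1 : ∀ j, αU j ≤ 1 / 64)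
        (_hαL : ∀ j, 50 * (d + 1) * αU j * (L : ℝ) ^ d ≤ 1 / 2)
        (hU1 : ∀ (j : ℕ) (x : B7Prop1Explicit.Site d) (k : Fin d), perCfg (towerP L m (j + 1)) (UlevOf L m (n + 1) U j) x k ∈ U1 𝔸)
        (hreg : ∀ (j : ℕ) (y : TSite d (towerP L m j)) (k : Fin d) (ρ' : Fin d → Fin L),
          ‖((Wcx L (perCfg (towerP L m (j + 1)) (UlevOf L m (n + 1) U j)) (cornerSite L y) k (boxVec L ρ') : 𝔸ˣ) : 𝔸) - 1‖ ≤ αU j)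
        (εU : ℕ → ℝ) (_hεU : ∀ j, 0 ≤ εU j) (_hε1 : ∀ j, εU j ≤ 1) (_hUε : ∀ (j : ℕ) (b : Bond d (towerP L m (j + 1))), ‖(UlevOf L m (n + 1) U j b : 𝔸) - 1‖ ≤ εU j)
        (_hLb : ∀ (j : ℕ) (b : Bond d (towerP L m (j + 1))), UlevOf L m (n + 1) U j b ∈ U1 𝔸)
        (α : ℝ) (_hα : 0 ≤ α) (_hαle : α ≤ α₁)
        (hUst : ∀ b, star (U b : 𝔸) = (((U b)⁻¹ : 𝔸ˣ) : 𝔸)) (_hUb : ∀ b, U b ∈ U1 𝔸) (_hUη : ∀ b, ‖(U b : 𝔸) - 1‖ ≤ α * η)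
        (_hUw : ∀ (x : TSite d (towerP L m (n + 1))) (μ ν : Fin d), ‖(U (shift ν x, μ) : 𝔸) - (U (x, μ) : 𝔸)‖ ≤ α * η ^ 2)
        (_hpl : ∀ p : B9SectCLatticeCarrier.Plaq d (towerP L m (n + 1)), ‖(plaqHolU U p : 𝔸) - 1‖ ≤ α * η ^ 2)
        (_hUgrad : ∀ (x : TSite d (towerP L m (n + 1))) (μ : Fin d), ‖(U (x, μ) : 𝔸) - U (unshift μ x, μ)‖ ≤ α * η ^ 2)
        (_hRlev : ∀ (j : ℕ) (b : Bond d (towerP L m (j + 1))) (w : W), ‖adTransportW φ (UlevOf L m (n + 1) U j) b w‖ ≤ ‖w‖)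
        (_hεg : ∀ j < n + 1, εU j ≤ α * ϱ ^ j) (_hAQ : ∑ j ∈ Finset.range (n + 1), αU j ≤ AQ)
        (hpos' : ∀ x : SiteL2K ℂ d (towerP L m (n + 1)) c₀ W, x ≠ 0 → 0 < RCLike.re ⟪x, laplacePrimeAk L m n φ η U a' (c₁ := c₁) x⟫_ℂ)
        (hpos : ∀ x : BondL2K ℂ d (towerP L m (n + 1)) c₀ W, x ≠ 0 →
          0 < RCLike.re ⟪x, laplaceAk L m n φ η U hL αU hα1 hU1 hreg τ (c₀ := c₀) (c₁ := c₁) a x⟫_ℂ)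
        (_hc₀η : c₀ = η ^ d) (j₀ : ℝ) (_hJ : ∀ μ y, ‖B9Eq39Adjoint.J (fun μ => B9Eq33CovDerivVector.shiftEquiv μ) (fun μ y => U (y, μ)) η μ y‖ ≤ j₀) (_hj : j₀ ≤ j₁)
        (hposπ : ∀ x : BondL2K ℂ d (towerP L m (n + 1)) c₀ W, x ≠ 0 →
          0 < RCLike.re ⟪x, laplaceAkPi L m n φ τ η U a' hpos' hL αU hα1 hU1 hreg (c₁ := c₁) a x⟫_ℂ)
        (hQ : Function.Surjective (QkW L m n φ U hL αU hα1 hU1 hreg (c₀ := c₀) (c₁ := c₁)))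
        (hpos'₁ : ∀ x : SiteL2K ℂ d (towerP L m (n + 1)) c₀ W, x ≠ 0 →
          0 < RCLike.re ⟪x, laplacePrimeAk L m n φ η (fun _ : Bond d (towerP L m (n + 1)) => (1 : 𝔸ˣ)) a' (c₁ := c₁) x⟫_ℂ)
        (hpos₁ : ∀ x : BondL2K ℂ d (towerP L m (n + 1)) c₀ W, x ≠ 0 →
          0 < RCLike.re ⟪x, laplaceAk L m n φ η (fun _ : Bond d (towerP L m (n + 1)) => (1 : 𝔸ˣ)) hL (fun _ => 0) (fun _ => by norm_num)
            (perCfg_UlevOf_one_mem_U1 L m (n + 1)) (norm_Wcx_UlevOf_one_sub_one_le L m (n + 1) (fun _ => 0) (fun _ => le_rfl)) τ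
            (c₀ := c₀) (c₁ := c₁) a x⟫_ℂ)
        (hQ1 : Function.Surjective (QkW L m n φ (fun _ : Bond d (towerP L m (n + 1)) => (1 : 𝔸ˣ)) hL (fun _ => 0) (fun _ => by norm_num)
          (perCfg_UlevOf_one_mem_U1 L m (n + 1)) (norm_Wcx_UlevOf_one_sub_one_le L m (n + 1) (fun _ => 0) (fun _ => le_rfl)) (c₀ := c₀) (c₁ := c₁)))
        (_hUG : ∀ (x : B7Prop1Explicit.Site d) (κ : Fin d), perCfg (towerP L m (n + 1)) U x κ ∈ G)
        (lev₀ : Bond d (towerP L m (n + 1)) → ℕ) (levB : Bond d m → ℕ) (lev₁ : Bond d (towerP L m (n + 1)) × Fin d → ℕ) (_hlev : ∀ b, n + 1 ≤ lev₀ b)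
        (_hw₀ : (NegSup.wSup (levWeight (L : ℝ) η lev₀ 1) : ℝ) ≤ ω) (_hw₁ : (NegSup.wSup (levWeight (L : ℝ) η lev₁ 2) : ℝ) ≤ ω)
        (_hw₁' : (NegSup.wInvSup (levWeight (L : ℝ) η lev₀ 1) : ℝ) ≤ Ω)
        (_hw₃ : (NegSup.wInvSup (levWeight (L : ℝ) η lev₀ 3) : ℝ) ≤ Ω) (_hwB : (NegSup.wInvSup (levWeight (L : ℝ) η levB 0) : ℝ) ≤ Ω)
        {W₁ : Space115 (L : ℝ) η lev₀ lev₁ (nabla115 η U) → NegSize (L : ℝ) η lev₀ 3 𝔸}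
        {W₂ : Space115 (L : ℝ) η lev₀ lev₁ (nabla115 η (fun _ : Bond d (towerP L m (n + 1)) => (1 : 𝔸ˣ))) → NegSize (L : ℝ) η lev₀ 3 𝔸}
        (_hW₁ : QuadAnalytic W₁ C₄ a₃) (_hW₂ : QuadAnalytic W₂ C₄ a₃) {δW δC : ℝ} (_hδW0 : 0 ≤ δW) (_hδC0 : 0 ≤ δC)
        (_hδW : ∀ P : Space115 (L : ℝ) η lev₀ lev₁ (nabla115 η U), ‖P‖ < r →
          ‖W₁ P - W₂ (LinearMap.toContinuousLinearMap
            ((jetLinearEquiv (L : ℝ) η lev₀ lev₁ (nabla115 η (fun _ : Bond d (towerP L m (n + 1)) => (1 : 𝔸ˣ)))).symm.toLinearMap ∘ₗ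
              (jetLinearEquiv (L : ℝ) η lev₀ lev₁ (nabla115 η U)).toLinearMap) P)‖ ≤ δW)
        (_hδC : ∀ P : Space115 (L : ℝ) η lev₀ lev₁ (nabla115 η U), ‖P‖ < r →
          ‖Cck L m η (n + 1) U lev₀ lev₁ (nabla115 η U) levB P -
            Cck L m η (n + 1) (fun _ : Bond d (towerP L m (n + 1)) => (1 : 𝔸ˣ)) lev₀ lev₁ (nabla115 η (fun _ : Bond d (towerP L m (n + 1)) => (1 : 𝔸ˣ))) levB
              (LinearMap.toContinuousLinearMap
                ((jetLinearEquiv (L : ℝ) η lev₀ lev₁ (nabla115 η (fun _ : Bond d (towerP L m (n + 1)) => (1 : 𝔸ˣ)))).symm.toLinearMap ∘ₗ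
                  (jetLinearEquiv (L : ℝ) η lev₀ lev₁ (nabla115 η U)).toLinearMap) P)‖ ≤ δC)
        (B : NegSize (L : ℝ) η levB 0 𝔸) (_hBb : ‖B‖ < Rb),
        ‖LinearMap.toContinuousLinearMap
              ((jetLinearEquiv (L : ℝ) η lev₀ lev₁ (nabla115 η (fun _ : Bond d (towerP L m (n + 1)) => (1 : 𝔸ˣ)))).symm.toLinearMap ∘ₗ
                (jetLinearEquiv (L : ℝ) η lev₀ lev₁ (nabla115 η U)).toLinearMap)
            (chartHB (frakGLatticeCLM (L := (L : ℝ)) (η := η) (lev₀ := lev₀) φ hposπ hQ lev₁ (nabla115 η U)) 0 W₁ 0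
              (fun A' => A' + solA (H1LatticeCLM (L := (L : ℝ)) (η := η) (lev₀ := lev₀) (levB := levB) φ hposπ hQ lev₁ (nabla115 η U)) 0
                (Cck L m η (n + 1) U lev₀ lev₁ (nabla115 η U) levB) 0 εC A') ε₄
              (H1LatticeCLM (L := (L : ℝ)) (η := η) (lev₀ := lev₀) (levB := levB) φ hposπ hQ lev₁ (nabla115 η U)) B) -
          chartHB (frakGLatticeCLM (L := (L : ℝ)) (η := η) (lev₀ := lev₀) (c := ((η : ℂ))⁻¹)
              (R := adTransportW φ (fun _ : Bond d (towerP L m (n + 1)) => (1 : 𝔸ˣ)))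
              (S := adTransportW φ fun _ : Bond d (towerP L m (n + 1)) => (1 : 𝔸ˣ)⁻¹) (Δ₁ := hessOp φ η (fun _ : Bond d (towerP L m (n + 1)) => (1 : 𝔸ˣ)) τ)
              (Rr := RofUk L m n φ η (fun _ : Bond d (towerP L m (n + 1)) => (1 : 𝔸ˣ)))
              (Q := (QkW L m n φ (fun _ : Bond d (towerP L m (n + 1)) => (1 : 𝔸ˣ)) hL (fun _ => 0) (fun _ => by norm_num)
                (perCfg_UlevOf_one_mem_U1 L m (n + 1)) (norm_Wcx_UlevOf_one_sub_one_le L m (n + 1) (fun _ => 0) (fun _ => le_rfl)) (c₀ := c₀) (c₁ := c₁))) (a := a)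
              φ hpos₁ hQ1 lev₁ (nabla115 η (fun _ : Bond d (towerP L m (n + 1)) => (1 : 𝔸ˣ)))) 0 W₂ 0
            (fun A' => A' + solA (H1LatticeCLM (L := (L : ℝ)) (η := η) (lev₀ := lev₀) (levB := levB) (c := ((η : ℂ))⁻¹)
              (R := adTransportW φ (fun _ : Bond d (towerP L m (n + 1)) => (1 : 𝔸ˣ)))
              (S := adTransportW φ fun _ : Bond d (towerP L m (n + 1)) => (1 : 𝔸ˣ)⁻¹) (Δ₁ := hessOp φ η (fun _ : Bond d (towerP L m (n + 1)) => (1 : 𝔸ˣ)) τ)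
              (Rr := RofUk L m n φ η (fun _ : Bond d (towerP L m (n + 1)) => (1 : 𝔸ˣ)))
              (Q := (QkW L m n φ (fun _ : Bond d (towerP L m (n + 1)) => (1 : 𝔸ˣ)) hL (fun _ => 0) (fun _ => by norm_num)
                (perCfg_UlevOf_one_mem_U1 L m (n + 1)) (norm_Wcx_UlevOf_one_sub_one_le L m (n + 1) (fun _ => 0) (fun _ => le_rfl)) (c₀ := c₀) (c₁ := c₁))) (a := a)
              φ hpos₁ hQ1 lev₁ (nabla115 η (fun _ : Bond d (towerP L m (n + 1)) => (1 : 𝔸ˣ)))) 0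
              (Cck L m η (n + 1) (fun _ : Bond d (towerP L m (n + 1)) => (1 : 𝔸ˣ)) lev₀ lev₁ (nabla115 η (fun _ : Bond d (towerP L m (n + 1)) => (1 : 𝔸ˣ))) levB) 0 εC A') ε₄
            (H1LatticeCLM (L := (L : ℝ)) (η := η) (lev₀ := lev₀) (levB := levB) (c := ((η : ℂ))⁻¹)
              (R := adTransportW φ (fun _ : Bond d (towerP L m (n + 1)) => (1 : 𝔸ˣ)))
              (S := adTransportW φ fun _ : Bond d (towerP L m (n + 1)) => (1 : 𝔸ˣ)⁻¹) (Δ₁ := hessOp φ η (fun _ : Bond d (towerP L m (n + 1)) => (1 : 𝔸ˣ)) τ)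
              (Rr := RofUk L m n φ η (fun _ : Bond d (towerP L m (n + 1)) => (1 : 𝔸ˣ)))
              (Q := (QkW L m n φ (fun _ : Bond d (towerP L m (n + 1)) => (1 : 𝔸ˣ)) hL (fun _ => 0) (fun _ => by norm_num)
                (perCfg_UlevOf_one_mem_U1 L m (n + 1)) (norm_Wcx_UlevOf_one_sub_one_le L m (n + 1) (fun _ => 0) (fun _ => le_rfl)) (c₀ := c₀) (c₁ := c₁))) (a := a)
              φ hpos₁ hQ1 lev₁ (nabla115 η (fun _ : Bond d (towerP L m (n + 1)) => (1 : 𝔸ˣ)))) B‖ ≤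
          K * ((j₀ + α) + δW + δC) := by
  classical
  -- (0) the suppliers, `∃`-first: the chart-level Lipschitz letters (ROUTE (J′)), the two operator norms, the scalar letters WITH ROOM
  obtain ⟨αL, jL, KA, KG, KD, hαL0, hjL, hKA, hKG, hKD, HLip⟩ :=
    exists_chartHB_lipschitz_at_flat_latticeFree hd L hL hL3 φ hMφ hMφ' hφ hφ' hstar ha ha' hϱ0 hϱ1 τ hτ hCτ hτm hMτ hρw hτ₁ hτ₂ hφτ AQ b hM₂ hrepr
  obtain ⟨αN, jN, BN, hαN, hjN, hBN, HN⟩ :=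
    exists_norm_chartLetters_le hd L hL hL3 φ hMφ hMφ' hφ hφ' hstar ha ha' hϱ0 hϱ1 τ hτ hCτ hτm hMτ hρw hτ₁ hτ₂ hφτ AQ
  obtain ⟨CG, hCGd⟩ : ∃ C : ℝ, C = ω * (Mφ * BN * Mφ') * Ω := ⟨_, rfl⟩
  have hCG : 0 ≤ CG := by rw [hCGd]; positivity
  obtain ⟨jr, ar, ε₄, aC, εC, Rb, hjr, har, hε₄, haC, hεC, hRb, hcap, -, ⟨hdom6, hcontr12, hCdom6, hCcontr12⟩, Hreg⟩ :=
    exists_twoRegimes_radii_of_bounds_room_cap (B₀ := CG) (b := CG) (b₁ := CG) (C₄ := C₄) (a₃ := a₃) (C₂ := C2T d α₀) (c₄ := ρ) (δ := 1)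
      hCG hCG hCG hC₄ ha₃ (C2T_nonneg d α₀) hρ0 one_pos
  -- the two denominators and the constant
  obtain ⟨D₁, hD₁⟩ : ∃ D : ℝ, D = 1 - (0 + 4 * CG * C₄ * (2 * (ε₄ + ar) + (ε₄ + ar))) := ⟨_, rfl⟩
  obtain ⟨D₂, hD₂⟩ : ∃ D : ℝ, D = 1 - 4 * CG * C2T d α₀ * (2 * (εC + aC) + (εC + aC)) := ⟨_, rfl⟩
  have hD₁0 : 0 < D₁ := by rw [hD₁]; linarith [hcontr12]
  have hD₂0 : 0 < D₂ := by rw [hD₂]; linarith [hCcontr12]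
  obtain ⟨Pw, hPw⟩ : ∃ P : ℝ, P = ω * (Mφ * Mφ') * Ω := ⟨_, rfl⟩
  have hPw0 : 0 ≤ Pw := by rw [hPw]; positivity
  obtain ⟨⟨X1, hX1⟩, ⟨X4, hX4⟩, ⟨X5, hX5⟩⟩ : (∃ X : ℝ, X = Pw * (KG + KD) * (jr + C₄ * (ε₄ + ar) ^ 2)) ∧ (∃ X : ℝ, X = Pw * KA * Rb) ∧
      (∃ X : ℝ, X = Pw * KA * (C2T d α₀ * (εC + aC) ^ 2)) := ⟨⟨_, rfl⟩, ⟨_, rfl⟩, ⟨_, rfl⟩⟩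
  have hC2T := C2T_nonneg d α₀
  obtain ⟨hX10, hX40, hX50⟩ : 0 ≤ X1 ∧ 0 ≤ X4 ∧ 0 ≤ X5 := ⟨by rw [hX1]; positivity, by rw [hX4]; positivity, by rw [hX5]; positivity⟩
  obtain ⟨c1, hc1⟩ : ∃ c : ℝ, c = 1 / D₂ * ((X1 + X4) / D₁) + X5 / D₂ := ⟨_, rfl⟩
  obtain ⟨⟨c2, hc2⟩, ⟨c3, hc3⟩⟩ : (∃ c : ℝ, c = 1 / D₂ * (CG / D₁)) ∧ (∃ c : ℝ, c = CG / D₂) := ⟨⟨_, rfl⟩, ⟨_, rfl⟩⟩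
  obtain ⟨hc10, hc20, hc30⟩ : 0 ≤ c1 ∧ 0 ≤ c2 ∧ 0 ≤ c3 := ⟨by rw [hc1]; positivity, by rw [hc2]; positivity, by rw [hc3]; positivity⟩
  obtain ⟨K, hK⟩ : ∃ K : ℝ, K = c1 + c2 + c3 + 1 := ⟨_, rfl⟩
  refine ⟨min (min αL αN) (min (α₀ / 2) (1 / (2 * ω * Ω + 1))), min jL jN, ε₄, εC, Rb, εC + aC, K,
    lt_min (lt_min hαL0 hαN) (lt_min (by positivity) (by positivity)), lt_min hjL hjN, hε₄, hεC, hRb, by linarith, by rw [hK]; positivity, ?_⟩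
  intro n η _ hηL c₀ c₁ _ _ hw hρ' m _ hm U αU hα0 hα1 hαL hU1 hreg εU hεU hε1 hUε hLb α hα hαle hUst hUb hUη hUw hpl hUgrad hRlev hεg hAQ hpos' hpos hc₀η j₀ hJ hj
    hposπ hQ hpos'₁ hpos₁ hQ1 hUG lev₀ levB lev₁ hlev hw₀ hw₁ hw₁' hw₃ hwB W₁ W₂ hW₁ hW₂ δW δC hδW0 hδC0 hδW hδC B hBb
  obtain ⟨hαL', hαN', hαh, hαw⟩ : α ≤ αL ∧ α ≤ αN ∧ α ≤ α₀ / 2 ∧ α ≤ 1 / (2 * ω * Ω + 1) :=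
    ⟨hαle.trans ((min_le_left _ _).trans (min_le_left _ _)), hαle.trans ((min_le_left _ _).trans (min_le_right _ _)),
      hαle.trans ((min_le_right _ _).trans (min_le_left _ _)), hαle.trans ((min_le_right _ _).trans (min_le_right _ _))⟩
  obtain ⟨hjL', hjN'⟩ : j₀ ≤ jL ∧ j₀ ≤ jN := ⟨hj.trans (min_le_left _ _), hj.trans (min_le_right _ _)⟩
  have hx : 0 ≤ j₀ + α := add_nonneg ((norm_nonneg _).trans (hJ ⟨0, hd⟩ fun _ => 0)) hα
  have hη0 : 0 < η := Fact.out
  -- (1) per lattice: (52) at `U` and at the vacuum from the plaquette window; `C_k`'s letters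
  have hηinv : ((L : ℝ) ^ (n + 1))⁻¹ = η := inv_eq_of_mul_eq_one_left hηL
  have h52 : pdev (perCfg (towerP L m (n + 1)) U) < α₀ * (((L : ℝ) ^ (n + 1))⁻¹) ^ 2 := by
    have hp := pdev_perCfg_le_of_plaq (U := U) hUb (by positivity) hpl
    rw [hηinv]
    exact lt_of_le_of_lt hp (mul_lt_mul_of_pos_right (by linarith) (by positivity))
  obtain ⟨-, hUη1, hpl1, hUgrad1, hJ1⟩ := flat_mem_class L m n η (𝔸 := 𝔸)
  have hUb1 : ∀ b' : Bond d (towerP L m (n + 1)), (fun _ : Bond d (towerP L m (n + 1)) => (1 : 𝔸ˣ)) b' ∈ U1 𝔸 := fun _ => one_mem _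
  have hUG1 : ∀ (x : B7Prop1Explicit.Site d) (κ : Fin d), perCfg (towerP L m (n + 1)) (fun _ : Bond d (towerP L m (n + 1)) => (1 : 𝔸ˣ)) x κ ∈ G :=
    fun x κ => by rw [B9Eq315QTorus.perCfg_apply]; exact G.one_mem
  have h52₁ : pdev (perCfg (towerP L m (n + 1)) (fun _ : Bond d (towerP L m (n + 1)) => (1 : 𝔸ˣ))) < α₀ * (((L : ℝ) ^ (n + 1))⁻¹) ^ 2 := by
    have hp := pdev_perCfg_le_of_plaq (U := fun _ : Bond d (towerP L m (n + 1)) => (1 : 𝔸ˣ)) hUb1 (by positivity : (0 : ℝ) ≤ 0 * η ^ 2) hpl1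
    rw [hηinv]
    exact lt_of_le_of_lt hp (mul_lt_mul_of_pos_right (by linarith) (by positivity))
  have hCk := quadAnalytic_Cck L m η (n + 1) U lev₀ lev₁ (nabla115 η U) levB hL2 hG hUG hα₀ hα3 hα4 h52 hlev hρ hρc
  have hCk1 := quadAnalytic_Cck L m η (n + 1) (fun _ : Bond d (towerP L m (n + 1)) => (1 : 𝔸ˣ)) lev₀ lev₁
    (nabla115 η (fun _ : Bond d (towerP L m (n + 1)) => (1 : 𝔸ˣ))) levB hL2 hG hUG1 hα₀ hα3 hα4 h52₁ hlev hρ hρc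
  -- the flat class data
  have hαL1 : ∀ j : ℕ, 50 * (d + 1) * (fun _ : ℕ => (0 : ℝ)) j * (L : ℝ) ^ d ≤ 1 / 2 := fun _ => by norm_num
  have hUε1 : ∀ (j : ℕ) (b' : Bond d (towerP L m (j + 1))), ‖(UlevOf L m (n + 1) (fun _ : Bond d (towerP L m (n + 1)) => (1 : 𝔸ˣ)) j b' : 𝔸) - 1‖ ≤ (fun _ : ℕ => (0 : ℝ)) j :=
    fun j b' => by rw [UlevOf_one]; simp
  have hLb1 : ∀ (j : ℕ) (b' : Bond d (towerP L m (j + 1))), UlevOf L m (n + 1) (fun _ : Bond d (towerP L m (n + 1)) => (1 : 𝔸ˣ)) j b' ∈ U1 𝔸 := fun j b' => by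
    rw [UlevOf_one]; exact one_mem _
  have hRlev1 : ∀ (j : ℕ) (b' : Bond d (towerP L m (j + 1))) (w : W), ‖adTransportW φ (UlevOf L m (n + 1) (fun _ : Bond d (towerP L m (n + 1)) => (1 : 𝔸ˣ)) j) b' w‖ ≤ ‖w‖ :=
    fun j b' w => by rw [UlevOf_one, B5Eq172HodgePositivity.adTransportW_one, LinearMap.id_apply]
  have hUst1 : ∀ b' : Bond d (towerP L m (n + 1)), star ((fun _ : Bond d (towerP L m (n + 1)) => (1 : 𝔸ˣ)) b' : 𝔸) =
      ((((fun _ : Bond d (towerP L m (n + 1)) => (1 : 𝔸ˣ)) b')⁻¹ : 𝔸ˣ) : 𝔸) := fun _ => by simp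
  have hεg1 : ∀ j < n + 1, (fun _ : ℕ => (0 : ℝ)) j ≤ 0 * ϱ ^ j := fun _ _ => by simp
  have hAQ1 : ∑ j ∈ Finset.range (n + 1), (fun _ : ℕ => (0 : ℝ)) j ≤ AQ := by simpa using (Finset.sum_nonneg fun j _ => hα0 j).trans hAQ
  have hposπ₁ := (laplaceAkPi_one_pos_iff L m n φ τ η a' hpos'₁ hL (fun _ => 0) (fun _ => by norm_num)
    (perCfg_UlevOf_one_mem_U1 L m (n + 1)) (norm_Wcx_UlevOf_one_sub_one_le L m (n + 1) (fun _ => 0) (fun _ => le_rfl)) a (c₀ := c₀)).mpr hpos₁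
  -- (2) the two operator norms at `U` and at the vacuum, against the ONE majorant `CG`
  obtain ⟨hGb, hHb⟩ := HN n η hηL c₀ c₁ hw hρ' m hm U αU hα0 hα1 hαL hU1 hreg εU hεU hUε hLb α hα hαN' hUst hUb hUη hpl hUgrad hRlev hεg hAQ hpos' hpos hc₀η
    j₀ hJ hjN' hposπ hQ (L : ℝ) η lev₀ lev₁ levB
  obtain ⟨hGb1, hHb1⟩ := HN n η hηL c₀ c₁ hw hρ' m hm (fun _ : Bond d (towerP L m (n + 1)) => (1 : 𝔸ˣ)) (fun _ => 0) (fun _ => le_rfl) (fun _ => by norm_num) hαL1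
    (perCfg_UlevOf_one_mem_U1 L m (n + 1)) (norm_Wcx_UlevOf_one_sub_one_le L m (n + 1) (fun _ => 0) (fun _ => le_rfl)) (fun _ => 0) (fun _ => le_rfl) hUε1 hLb1
    0 le_rfl hαN.le hUst1 hUb1 hUη1 hpl1 hUgrad1 hRlev1 hεg1 hAQ1 hpos'₁ hpos₁ hc₀η 0 hJ1 hjN.le hposπ₁ hQ1 (L : ℝ) η lev₀ lev₁ levB
  rw [frakGLatticeCLM_laplaceAkPi_one L hL φ τ m n η hpos'₁ hpos₁ hposπ₁ hQ1 lev₀ lev₁] at hGb1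
  rw [H1LatticeCLM_laplaceAkPi_one L hL φ τ m n η hpos'₁ hpos₁ hposπ₁ hQ1 lev₀ levB lev₁] at hHb1
  have hMB : 0 ≤ Mφ * BN * Mφ' := by positivity
  have hmax : max ((NegSup.wSup (levWeight (L : ℝ) η lev₀ 1) : ℝ) * (Mφ * BN * Mφ')) (NegSup.wSup (levWeight (L : ℝ) η lev₁ 2) * (Mφ * BN * Mφ')) ≤
      ω * (Mφ * BN * Mφ') :=
    max_le (mul_le_mul_of_nonneg_right hw₀ hMB) (mul_le_mul_of_nonneg_right hw₁ hMB)
  obtain ⟨hw3n, hwBn⟩ := And.intro (NegSup.wInvSup (levWeight (L : ℝ) η lev₀ 3)).coe_nonneg (NegSup.wInvSup (levWeight (L : ℝ) η levB 0)).coe_nonneg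
  have hωB : 0 ≤ ω * (Mφ * BN * Mφ') := by positivity
  have hGb' := hGb.trans ((mul_le_mul hmax hw₃ hw3n hωB).trans (le_of_eq hCGd.symm))
  have hHb' := hHb.trans ((mul_le_mul hmax hwB hwBn hωB).trans (le_of_eq hCGd.symm))
  have hGb1' := hGb1.trans ((mul_le_mul hmax hw₃ hw3n hωB).trans (le_of_eq hCGd.symm))
  have hHb1' := hHb1.trans ((mul_le_mul hmax hwB hwBn hωB).trans (le_of_eq hCGd.symm))
  -- (3) the four regimes and the datum letter, from the scalar letters with room
  obtain ⟨R₁, RC₁, hB₁⟩ := Hreg _ W₁ _ _ _ (fun f => (ContinuousLinearMap.le_opNorm _ f).trans (mul_le_mul_of_nonneg_right hGb' (norm_nonneg f))) hW₁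
    (fun Y => (ContinuousLinearMap.le_opNorm _ Y).trans (mul_le_mul_of_nonneg_right hHb' (norm_nonneg Y))) hCk
    (fun Y => (ContinuousLinearMap.le_opNorm _ Y).trans (mul_le_mul_of_nonneg_right hHb' (norm_nonneg Y)))
  obtain ⟨R₂, RC₂, hB₂⟩ := Hreg _ W₂ _ _ _ (fun f => (ContinuousLinearMap.le_opNorm _ f).trans (mul_le_mul_of_nonneg_right hGb1' (norm_nonneg f))) hW₂
    (fun Y => (ContinuousLinearMap.le_opNorm _ Y).trans (mul_le_mul_of_nonneg_right hHb1' (norm_nonneg Y))) hCk1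
    (fun Y => (ContinuousLinearMap.le_opNorm _ Y).trans (mul_le_mul_of_nonneg_right hHb1' (norm_nonneg Y)))
  obtain ⟨hBU, hB1⟩ := And.intro (hB₁ B (mem_ball_zero_iff.mpr hBb)) (hB₂ B (mem_ball_zero_iff.mpr hBb))
  -- the jet identity's letter `K_ι = 1 + w̄₁·2α·w̲₁⁻¹ ≤ 2`
  have hKι : 1 + (NegSup.wSup (levWeight (L : ℝ) η lev₁ 2) : ℝ) * (2 * α) * NegSup.wInvSup (levWeight (L : ℝ) η lev₀ 1) ≤ 2 := by
    have h1 : (NegSup.wSup (levWeight (L : ℝ) η lev₁ 2) : ℝ) * (2 * α) * NegSup.wInvSup (levWeight (L : ℝ) η lev₀ 1) ≤ ω * (2 * α) * Ω :=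
      mul_le_mul (mul_le_mul_of_nonneg_right hw₁ (by positivity)) hw₁' (NegSup.wInvSup (levWeight (L : ℝ) η lev₀ 1)).coe_nonneg (by positivity)
    have h2 : α * (2 * ω * Ω + 1) ≤ 1 := by rw [← le_div_iff₀ (by positivity)]; exact hαw
    nlinarith [mul_nonneg hω hΩ, mul_nonneg (mul_nonneg hω hΩ) hα, h1, h2]
  obtain ⟨hs0, hsC0⟩ : 0 < ε₄ + ar ∧ 0 < εC + aC := ⟨by linarith, by linarith⟩
  -- (4) THE CHART-LEVEL COMPOSITION with every scalar letter produced
  have hmain := HLip n η hηL c₀ c₁ hw hρ' m hm U αU hα0 hα1 hαL hU1 hreg εU hεU hε1 hUε hLb α hα hαL' hUst hUb hUη hUw hpl hUgrad hRlev hεg hAQ hpos' hpos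
    hc₀η j₀ hJ hjL' hposπ hQ hpos'₁ hpos₁ hQ1 lev₀ levB lev₁ R₁ R₂ hjr.le hjr.le B hBU hB1
    (fun P hP => hδW P (hP.trans_le (hcap.trans (by linarith))))
    (show (1 + (NegSup.wSup (levWeight (L : ℝ) η lev₁ 2) : ℝ) * (2 * α) * NegSup.wInvSup (levWeight (L : ℝ) η lev₀ 1)) * (ε₄ + ar) ≤ 2 * (ε₄ + ar) from
      mul_le_mul_of_nonneg_right hKι hs0.le)
    (show ε₄ + ar ≤ 2 * (ε₄ + ar) by linarith) (show 0 < ε₄ + ar from hs0) (show 2 * (2 * (ε₄ + ar) + (ε₄ + ar)) ≤ a₃ by linarith)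
    (show 0 + 4 * CG * C₄ * (2 * (ε₄ + ar) + (ε₄ + ar)) < 1 by linarith) RC₁ RC₂ hcap hcap hδC
    (show (1 + (NegSup.wSup (levWeight (L : ℝ) η lev₁ 2) : ℝ) * (2 * α) * NegSup.wInvSup (levWeight (L : ℝ) η lev₀ 1)) * (εC + aC) ≤ 2 * (εC + aC) from
      mul_le_mul_of_nonneg_right hKι hsC0.le)
    (show εC + aC ≤ 2 * (εC + aC) by linarith) (show 0 < εC + aC from hsC0) (show 2 * (2 * (εC + aC) + (εC + aC)) ≤ ρ by linarith)
    (show 4 * CG * C2T d α₀ * (2 * (εC + aC) + (εC + aC)) < 1 by linarith)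
  rw [← hD₁, ← hD₂] at hmain
  refine hmain.trans ?_
  -- (5) the constants
  obtain ⟨hw0n, hw1n⟩ := And.intro (NegSup.wSup (levWeight (L : ℝ) η lev₀ 1)).coe_nonneg (NegSup.wSup (levWeight (L : ℝ) η lev₁ 2)).coe_nonneg
  have hMle : ∀ {X Y : ℝ}, 0 ≤ X → X ≤ Y → ∀ {v : ℝ}, 0 ≤ v → v ≤ Ω →
      max ((NegSup.wSup (levWeight (L : ℝ) η lev₀ 1) : ℝ) * (Mφ * ((j₀ + α) * X) * Mφ')) (NegSup.wSup (levWeight (L : ℝ) η lev₁ 2) * (Mφ * ((j₀ + α) * X) * Mφ')) * v ≤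
        (j₀ + α) * (Pw * Y) := by
    intro X Y hX0 hXY v hv0 hvΩ
    have h1 : Mφ * ((j₀ + α) * X) * Mφ' ≤ Mφ * ((j₀ + α) * Y) * Mφ' := mul_le_mul_of_nonneg_right (mul_le_mul_of_nonneg_left (mul_le_mul_of_nonneg_left hXY hx) hMφ) hMφ'
    have h0 : 0 ≤ Mφ * ((j₀ + α) * Y) * Mφ' := by have := hX0.trans hXY; positivity
    have hM : max ((NegSup.wSup (levWeight (L : ℝ) η lev₀ 1) : ℝ) * (Mφ * ((j₀ + α) * X) * Mφ')) (NegSup.wSup (levWeight (L : ℝ) η lev₁ 2) * (Mφ * ((j₀ + α) * X) * Mφ')) ≤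
        ω * (Mφ * ((j₀ + α) * Y) * Mφ') :=
      max_le ((mul_le_mul_of_nonneg_left h1 hw0n).trans (mul_le_mul_of_nonneg_right hw₀ h0)) ((mul_le_mul_of_nonneg_left h1 hw1n).trans (mul_le_mul_of_nonneg_right hw₁ h0))
    calc _ ≤ ω * (Mφ * ((j₀ + α) * Y) * Mφ') * Ω := mul_le_mul hM hvΩ hv0 (mul_nonneg hω h0)
      _ = (j₀ + α) * (Pw * Y) := by rw [hPw]; ring
  have ht1 := hMle hKG (show KG ≤ KG + KD by linarith) hw3n hw₃
  have ht1' := hMle hKD (show KD ≤ KG + KD by linarith) hw3n hw₃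
  have ht2 := hMle hKA le_rfl hwBn hwB
  have hmaxGD : max ((NegSup.wSup (levWeight (L : ℝ) η lev₀ 1) : ℝ) * (Mφ * ((j₀ + α) * KG) * Mφ')) (NegSup.wSup (levWeight (L : ℝ) η lev₁ 2) * (Mφ * ((j₀ + α) * KD) * Mφ')) *
      NegSup.wInvSup (levWeight (L : ℝ) η lev₀ 3) ≤ (j₀ + α) * (Pw * (KG + KD)) := by
    rcases le_total ((NegSup.wSup (levWeight (L : ℝ) η lev₀ 1) : ℝ) * (Mφ * ((j₀ + α) * KG) * Mφ')) (NegSup.wSup (levWeight (L : ℝ) η lev₁ 2) * (Mφ * ((j₀ + α) * KD) * Mφ')) with h | h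
    · rw [max_eq_right h]; exact (mul_le_mul_of_nonneg_right (le_max_right _ _) hw3n).trans ht1'
    · rw [max_eq_left h]; exact (mul_le_mul_of_nonneg_right (le_max_left _ _) hw3n).trans ht1
  have hnum1 : max ((NegSup.wSup (levWeight (L : ℝ) η lev₀ 1) : ℝ) * (Mφ * ((j₀ + α) * KG) * Mφ')) (NegSup.wSup (levWeight (L : ℝ) η lev₁ 2) * (Mφ * ((j₀ + α) * KD) * Mφ')) *
        NegSup.wInvSup (levWeight (L : ℝ) η lev₀ 3) * (jr + C₄ * (ε₄ + ar) ^ 2) + 0 * (ε₄ + ar) + CG * δW +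
      max ((NegSup.wSup (levWeight (L : ℝ) η lev₀ 1) : ℝ) * (Mφ * ((j₀ + α) * KA) * Mφ')) (NegSup.wSup (levWeight (L : ℝ) η lev₁ 2) * (Mφ * ((j₀ + α) * KA) * Mφ')) *
        NegSup.wInvSup (levWeight (L : ℝ) η levB 0) * ‖B‖ ≤ (j₀ + α) * (X1 + X4) + CG * δW := by
    have h1 := mul_le_mul_of_nonneg_right hmaxGD (show 0 ≤ jr + C₄ * (ε₄ + ar) ^ 2 by positivity)
    have h2 := mul_le_mul ht2 hBb.le (norm_nonneg B) (by positivity)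
    rw [hX1, hX4]; linarith [h1, h2]
  have hnum2 : max ((NegSup.wSup (levWeight (L : ℝ) η lev₀ 1) : ℝ) * (Mφ * ((j₀ + α) * KA) * Mφ')) (NegSup.wSup (levWeight (L : ℝ) η lev₁ 2) * (Mφ * ((j₀ + α) * KA) * Mφ')) *
        NegSup.wInvSup (levWeight (L : ℝ) η levB 0) * (C2T d α₀ * (εC + aC) ^ 2) + CG * δC ≤ (j₀ + α) * X5 + CG * δC := by
    have h1 := mul_le_mul_of_nonneg_right ht2 (show 0 ≤ C2T d α₀ * (εC + aC) ^ 2 by positivity)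
    rw [hX5]; linarith [h1]
  have hiD₂ : 0 ≤ 1 / D₂ := div_nonneg zero_le_one hD₂0.le
  refine (add_le_add (mul_le_mul_of_nonneg_left (div_le_div_of_nonneg_right hnum1 hD₁0.le) hiD₂) (div_le_div_of_nonneg_right hnum2 hD₂0.le)).trans ?_
  have e : 1 / D₂ * (((j₀ + α) * (X1 + X4) + CG * δW) / D₁) + ((j₀ + α) * X5 + CG * δC) / D₂ = (j₀ + α) * c1 + δW * c2 + δC * c3 := by
    rw [hc1, hc2, hc3]; field_simp; ring
  rw [e, hK]
  linarith [mul_nonneg hx (show 0 ≤ c2 + c3 + 1 by positivity), mul_nonneg hδW0 (show 0 ≤ c1 + c3 + 1 by positivity), mul_nonneg hδC0 (show 0 ≤ c1 + c2 + 1 by positivity)]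

end Summit.QuantumFields.BalabanUV.T4Continuum.NE9CurChartTowerPiLipschitzAtFlatLatticeUniform

end
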